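import Mathlib.Algebra.BigOperators.Ring.Finset
import Mathlib.Algebra.Order.BigOperators.Ring.Finset
import Mathlib.Data.Fintype.BigOperators
import Mathlib.Data.Fintype.Pi
import Mathlib.Logic.Equiv.Fintype
import Mathlib.Data.Real.Basic
import HarnessLib

/-!
# Independence of disjointly supported statistics on the Boolean cube, counting form

On the uniform cube `{0,1}^E` (all maps `x : E → Bool`, counting measure), statistics depending
on disjoint sets of coordinates are independent. In the measure-free counting language used by
the tree's combinatorial probability files (`Moments/HoeffdingCounting.lean`,
`Moments/BinomialTailCounting.lean`) this is the product rule

  `(Σₓ g x · h x) · 2^{#E} = (Σₓ g x) · (Σₓ h x)`      (`sum_mul_sum_eq_of_dependsOn`)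

for `g` determined by the coordinates in `A` and `h` by those outside `A`, together with its
consequences for events (`card_filter_and_mul_eq`) and the exact count of the cylinder
`{x : x|_D ≡ true}` (`card_filter_forall_eq_true_mul_eq`: `2^{#E - #D}` points). These are the
"edges in disjoint sets are independent" steps of random-graph arguments (e.g. conditioning on a
common neighbourhood in Alon–Krivelevich–Sudakov 1998, §2.3).

The proof is the product decomposition `(E → Bool) ≃ (A → Bool) × (Aᶜ → Bool)`
(Mathlib's `Equiv.piEquivPiSubtypeProd`; its inverse is written `glue A` below, a local notation)
and Fubini for finite sums.

## References

* N. Alon, M. Krivelevich, B. Sudakov, *Finding a large hidden clique in a random graph*, Random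
  Structures Algorithms 13 (1998) 457–466, §2.3 ("expose the edges from `S` to `V ∖ S` thus
  fixing `N*(S)`, and then expose all the edges inside `N*(S)`") [AlonKrivelevichSudakov1998].
  The product rule itself is folklore (product probability spaces).
-/

noncomputable section

open Finset

namespace Literature.Probability.Moments

variable {E : Type*} [Fintype E] [DecidableEq E]

/-! ### The product decomposition of the cube along a set of coordinates -/

/-- Notation (local, not a declaration): `glue A p` is the point of the cube that is `p.1` on `A`
and `p.2` off `A` — the inverse of restriction, Mathlib's `Equiv.piEquivPiSubtypeProd`. -/
local notation3 (prettyPrint := false) "glue " A:arg =>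
  ⇑(Equiv.piEquivPiSubtypeProd (fun e => e ∈ (A : Finset _)) (fun _ => Bool)).symm

omit [Fintype E] in
/-- On `A` the glued point is the first component. [folklore] -/
theorem glue_apply_of_mem (A : Finset E) (y : {e // e ∈ A} → Bool) (z : {e // e ∉ A} → Bool)
    {e : E} (he : e ∈ A) : (glue A) (y, z) e = y ⟨e, he⟩ := by
  simp [Equiv.piEquivPiSubtypeProd_symm_apply, he]

omit [Fintype E] in
/-- Off `A` the glued point is the second component. [folklore] -/
theorem glue_apply_of_not_mem (A : Finset E) (y : {e // e ∈ A} → Bool) (z : {e // e ∉ A} → Bool)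
    {e : E} (he : e ∉ A) : (glue A) (y, z) e = z ⟨e, he⟩ := by
  simp [Equiv.piEquivPiSubtypeProd_symm_apply, he]

/-- Fubini on the cube along `A`: `Σₓ F x = Σ_y Σ_z F (glue (y, z))`. [folklore] -/
theorem sum_cube_eq_sum_sum_glue (A : Finset E) (F : (E → Bool) → ℝ) :
    ∑ x, F x = ∑ y : {e // e ∈ A} → Bool, ∑ z : {e // e ∉ A} → Bool, F ((glue A) (y, z)) := by
  rw [← Fintype.sum_prod_type']
  exact (Fintype.sum_equiv (Equiv.piEquivPiSubtypeProd (fun e => e ∈ A) (fun _ => Bool)).symm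
    _ _ fun p => rfl).symm

omit [Fintype E] in
/-- The cardinalities of the two factors: `2^{#A}` and `2^{#E - #A}`. [folklore] -/
theorem card_fun_mem_eq (A : Finset E) : Fintype.card ({e // e ∈ A} → Bool) = 2 ^ A.card := by
  rw [Fintype.card_fun, Fintype.card_bool, Fintype.card_coe]

/-- The cardinality of the complementary factor. [folklore] -/
theorem card_fun_not_mem_eq (A : Finset E) :
    Fintype.card ({e // e ∉ A} → Bool) = 2 ^ (Fintype.card E - A.card) := by
  rw [Fintype.card_fun, Fintype.card_bool]
  congr 1
  rw [Fintype.card_subtype_compl, Fintype.card_coe]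

omit [DecidableEq E] in
/-- `#A ≤ #E`, so that `2^{#A} · 2^{#E - #A} = 2^{#E}`. [folklore] -/
theorem two_pow_card_mul (A : Finset E) :
    (2 : ℝ) ^ A.card * 2 ^ (Fintype.card E - A.card) = 2 ^ Fintype.card E := by
  rw [← pow_add, Nat.add_sub_cancel' (card_le_univ A)]

/-! ### The product rule -/

/-- **Independence of disjointly supported statistics, counting form.** If `g` depends only on
the coordinates in `A` and `h` only on the coordinates outside `A`, then
`(Σₓ g x · h x) · 2^{#E} = (Σₓ g x) · (Σₓ h x)`. [folklore] -/
theorem sum_mul_sum_eq_of_dependsOn (A : Finset E) (g h : (E → Bool) → ℝ)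
    (hg : ∀ x x' : E → Bool, (∀ e ∈ A, x e = x' e) → g x = g x')
    (hh : ∀ x x' : E → Bool, (∀ e, e ∉ A → x e = x' e) → h x = h x') :
    (∑ x, g x * h x) * 2 ^ Fintype.card E = (∑ x, g x) * ∑ x, h x := by
  classical
  -- reference points for the irrelevant coordinates
  set z₀ : {e // e ∉ A} → Bool := fun _ => false
  set y₀ : {e // e ∈ A} → Bool := fun _ => false
  set G : ({e // e ∈ A} → Bool) → ℝ := fun y => g ((glue A) (y, z₀)) with hG
  set H : ({e // e ∉ A} → Bool) → ℝ := fun z => h ((glue A) (y₀, z)) with hH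
  have hgG : ∀ y z, g ((glue A) (y, z)) = G y := fun y z =>
    hg _ _ fun e he => by rw [glue_apply_of_mem _ _ _ he, glue_apply_of_mem _ _ _ he]
  have hhH : ∀ y z, h ((glue A) (y, z)) = H z := fun y z =>
    hh _ _ fun e he => by rw [glue_apply_of_not_mem _ _ _ he, glue_apply_of_not_mem _ _ _ he]
  have h1 : ∑ x, g x * h x = (∑ y, G y) * ∑ z, H z := by
    rw [sum_cube_eq_sum_sum_glue A, sum_mul_sum]
    exact sum_congr rfl fun y _ => sum_congr rfl fun z _ => by rw [hgG, hhH]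
  have h2 : ∑ x, g x = (∑ y, G y) * 2 ^ (Fintype.card E - A.card) := by
    rw [sum_cube_eq_sum_sum_glue A, sum_mul]
    refine sum_congr rfl fun y _ => ?_
    rw [sum_congr rfl fun z _ => hgG y z, sum_const, card_univ, card_fun_not_mem_eq, nsmul_eq_mul,
      mul_comm]
    norm_cast
  have h3 : ∑ x, h x = 2 ^ A.card * ∑ z, H z := by
    rw [sum_cube_eq_sum_sum_glue A]
    rw [sum_congr rfl fun y _ => sum_congr rfl fun z _ => hhH y z, sum_const, card_univ,
      card_fun_mem_eq, nsmul_eq_mul]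
    norm_cast
  rw [h1, h2, h3, ← two_pow_card_mul A]
  ring

/-- The product rule for a statistic supported in `A` and one supported in a set `B` disjoint
from `A`. [folklore] -/
theorem sum_mul_sum_eq_of_disjoint {A B : Finset E} (hAB : Disjoint A B) (g h : (E → Bool) → ℝ)
    (hg : ∀ x x' : E → Bool, (∀ e ∈ A, x e = x' e) → g x = g x')
    (hh : ∀ x x' : E → Bool, (∀ e ∈ B, x e = x' e) → h x = h x') :
    (∑ x, g x * h x) * 2 ^ Fintype.card E = (∑ x, g x) * ∑ x, h x :=
  sum_mul_sum_eq_of_dependsOn A g h hg fun x x' hx =>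
    hh x x' fun e he => hx e (disjoint_right.1 hAB he)

/-- **Independence of disjointly determined events, counting form**:
`#{x : P x ∧ Q x} · 2^{#E} = #{x : P x} · #{x : Q x}` when `P` is determined by the coordinates in
`A`, `Q` by those in `B`, and `A ∩ B = ∅`. [folklore] -/
theorem card_filter_and_mul_eq {A B : Finset E} (hAB : Disjoint A B) (P Q : (E → Bool) → Prop)
    [DecidablePred P] [DecidablePred Q]
    (hP : ∀ x x' : E → Bool, (∀ e ∈ A, x e = x' e) → (P x ↔ P x'))
    (hQ : ∀ x x' : E → Bool, (∀ e ∈ B, x e = x' e) → (Q x ↔ Q x')) :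
    ((univ.filter fun x => P x ∧ Q x).card : ℝ) * 2 ^ Fintype.card E =
      ((univ.filter fun x => P x).card : ℝ) * (univ.filter fun x => Q x).card := by
  classical
  have h := sum_mul_sum_eq_of_disjoint hAB (fun x => if P x then (1 : ℝ) else 0)
    (fun x => if Q x then (1 : ℝ) else 0)
    (fun x x' hx => by simp only [hP x x' hx]) (fun x x' hx => by simp only [hQ x x' hx])
  have hprod : ∀ x, (if P x then (1 : ℝ) else 0) * (if Q x then (1 : ℝ) else 0) =
      if P x ∧ Q x then 1 else 0 := fun x => by
    by_cases hp : P x <;> by_cases hq : Q x <;> simp [hp, hq]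
  simp only [hprod] at h
  rw [sum_boole, sum_boole, sum_boole] at h
  simpa using h

/-- **The cylinder count**: the points of the cube that are `true` on `D` number exactly
`2^{#E - #D}`, i.e. `#{x : ∀ e ∈ D, x e} · 2^{#D} = 2^{#E}`. [folklore] -/
theorem card_filter_forall_eq_true_mul_eq (D : Finset E) :
    (univ.filter fun x : E → Bool => ∀ e ∈ D, x e = true).card * 2 ^ D.card =
      2 ^ Fintype.card E := by
  classical
  -- the cylinder is the image of `{all-true} × (Dᶜ → Bool)` under `glue`
  have himage : (univ.filter fun x : E → Bool => ∀ e ∈ D, x e = true) =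
      (univ : Finset ({e // e ∉ D} → Bool)).image fun z => (glue D) (fun _ => true, z) := by
    ext x
    simp only [mem_filter, mem_univ, true_and, mem_image]
    constructor
    · intro hx
      refine ⟨fun e => x e, funext fun e => ?_⟩
      by_cases he : e ∈ D
      · rw [glue_apply_of_mem _ _ _ he, hx e he]
      · rw [glue_apply_of_not_mem _ _ _ he]
    · rintro ⟨z, rfl⟩ e he
      rw [glue_apply_of_mem _ _ _ he]
  have hinj : Function.Injective fun z : {e // e ∉ D} → Bool => (glue D) (fun _ => true, z) := by
    intro z z' h
    funext ⟨e, he⟩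
    have h' : (glue D) (fun _ => true, z) e = (glue D) (fun _ => true, z') e := congr_fun h e
    rwa [glue_apply_of_not_mem _ _ _ he, glue_apply_of_not_mem _ _ _ he] at h'
  rw [himage, card_image_of_injective _ hinj, card_univ, card_fun_not_mem_eq, ← pow_add,
    Nat.sub_add_cancel (card_le_univ D)]

/-- The cylinder count as a probability: `#{x : ∀ e ∈ D, x e} = 2^{#E} / 2^{#D}` over `ℝ`.
[folklore] -/
theorem card_filter_forall_eq_true_eq_div (D : Finset E) :
    ((univ.filter fun x : E → Bool => ∀ e ∈ D, x e = true).card : ℝ) =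
      2 ^ Fintype.card E / 2 ^ D.card := by
  rw [eq_div_iff (pow_ne_zero _ two_ne_zero)]
  exact_mod_cast card_filter_forall_eq_true_mul_eq D

end Literature.Probability.Moments

end
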